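import Summits.Parity.GeneralizedHardyLittlewood.Theorems.PrimeLevelFamEdgeMomentsBeyondDiagonalDiagBoseB0Leading
import Summits.Parity.GeneralizedHardyLittlewood.Theorems.PrimeLevelFamEdgeMomentsBeyondDiagonalDiagBoseB0Integrable
import HarnessLib

/-!
# Route `PrimeLevelFamEdge`, crux K_A `MomentsBeyondDiagonal` (stmt-Parity-20007), line «petersson_layers» v4, stub `stub_diag`:
# **census R2: the one-dimensional Bose moments with the two-sided weight `(log u)^a (log(y/u))^b`**

Integration by parts in the inner variable of the mixed Bose coefficient `c_ab` (`b ≥ 1`) produces the boundary moment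
`∫₀^∞ (log u)^a (log(y/u))^b (e^{u+y/u} − 1)⁻¹ du` (the kernel `B = −d/dφ (e^φ−1)⁻¹`). Since `log(y/u) = −(L + log u)`,
`L = log(1/y)`, the binomial theorem and `…DiagBoseB0Leading.bose_coeff_a0_leading` give its leading term:

* `bose0_moment_two_sided_leading` — **`∫₀^∞ (log u)^a (log(y/u))^b (e^{u+y/u}−1)⁻¹ du
  = (−1)^{a+b}·β_{ab}·L^{a+b+1} + O_{a,b}((1+L)^{a+b})`**, `β_{ab} = Σ_{k≤b} C(b,k)(−1)^k 2^{−(a+k+1)}/(a+k+1)`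
  (`= ∫₀^{1/2} t^a(1−t)^b dt`), for `0 < y ≤ 1`.

Def-free; theorems only. Helper `--supports stmt-Parity-20007`; closes nothing; K_A, K_B and the Parity summit are NOT
proved; nothing about Landau–Siegel zeros.

## References
* E. Kowalski, P. Michel, J. VanderKam, J. reine angew. Math. 526 (2000), (22)–(28) pp. 12–15.
  [cite: KowalskiMichelVanderKam2000, (22)–(28) — derivation (residues of the diagonal weight)]
-/

noncomputable section

open Real Set MeasureTheory Finset

namespace Summit.Parity.GeneralizedHardyLittlewood.Theorems.MomentsBeyondDiagonal.DiagLines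

/-- **The two-sided Bose moment.** For all `a, b` there is `C` such that for `0 < y ≤ 1`, `L = log(1/y)`:
`|∫₀^∞ (log u)^a (log(y/u))^b (e^{u+y/u}−1)⁻¹ du − (−1)^{a+b}·(Σ_{k≤b} C(b,k)(−1)^k/2^{a+k+1}/(a+k+1))·L^{a+b+1}| ≤ C(1+L)^{a+b}`.
[cite: KowalskiMichelVanderKam2000, (22)–(28) — derivation (two-sided log moments of the diagonal weight)] -/
theorem bose0_moment_two_sided_leading (a b : ℕ) : ∃ C : ℝ, ∀ y : ℝ, 0 < y → y ≤ 1 →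
    |(∫ u in Ioi (0 : ℝ), Real.log u ^ a * Real.log (y / u) ^ b * (Real.exp (u + y / u) - 1)⁻¹) -
        (-1) ^ (a + b) * (∑ k ∈ range (b + 1), (b.choose k : ℝ) * (-1) ^ k / 2 ^ (a + k + 1) /
          ((a : ℝ) + k + 1)) * Real.log (1 / y) ^ (a + b + 1)| ≤ C * (1 + Real.log (1 / y)) ^ (a + b) := by
  -- one constant per order `a + k`
  have hC : ∀ k : ℕ, ∃ C : ℝ, ∀ y : ℝ, 0 < y → y ≤ 1 →
      |(∫ u in Ioi (0 : ℝ), Real.log u ^ (a + k) * (Real.exp (u + y / u) - 1)⁻¹) -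
        (-1) ^ (a + k) * (Real.log (1 / y) / 2) ^ (a + k + 1) / ((a + k : ℕ) + 1 : ℝ)| ≤
        C * (1 + Real.log (1 / y)) ^ (a + k) := fun k ↦ bose_coeff_a0_leading (a + k)
  choose Cf hCf using hC
  have hCf0 : ∀ k, 0 ≤ Cf k := by
    intro k
    have h := hCf k 1 one_pos le_rfl
    have : (0 : ℝ) ≤ Cf k * (1 + Real.log (1 / 1)) ^ (a + k) := (abs_nonneg _).trans h
    simpa using this
  refine ⟨∑ k ∈ range (b + 1), (b.choose k : ℝ) * Cf k, fun y hy0 hy1 ↦ ?_⟩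
  set L : ℝ := Real.log (1 / y) with hL
  have hLdef : L = -Real.log y := by rw [hL, one_div, Real.log_inv]
  have hL0 : 0 ≤ L := by rw [hLdef]; have := Real.log_nonpos hy0.le hy1; linarith
  set K : ℝ → ℝ := fun u ↦ (Real.exp (u + y / u) - 1)⁻¹ with hK
  -- binomial expansion of the two-sided weight on `(0, ∞)`
  have hexp : ∀ u ∈ Ioi (0 : ℝ), Real.log u ^ a * Real.log (y / u) ^ b * K u =
      ∑ k ∈ range (b + 1), ((-1) ^ b * (b.choose k : ℝ) * L ^ (b - k)) * (Real.log u ^ (a + k) * K u) := by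
    intro u hu
    have hu : 0 < u := hu
    have hlog : Real.log (y / u) = -(Real.log u + L) := by
      rw [Real.log_div hy0.ne' hu.ne', hLdef]; ring
    rw [hlog, neg_pow, add_pow, Finset.mul_sum, Finset.mul_sum, Finset.sum_mul]
    refine Finset.sum_congr rfl fun k _ ↦ ?_
    rw [pow_add]
    ring
  have hint : ∫ u in Ioi (0 : ℝ), Real.log u ^ a * Real.log (y / u) ^ b * K u =
      ∑ k ∈ range (b + 1), ((-1) ^ b * (b.choose k : ℝ) * L ^ (b - k)) *
        ∫ u in Ioi (0 : ℝ), Real.log u ^ (a + k) * K u := by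
    rw [setIntegral_congr_fun measurableSet_Ioi hexp,
      integral_finsetSum _ fun k _ ↦ (integrableOn_log_pow_mul_bose0 hy0 (a + k)).const_mul _]
    exact Finset.sum_congr rfl fun k _ ↦ integral_const_mul _ _
  -- the main term, expanded the same way
  have hmain : (-1) ^ (a + b) * (∑ k ∈ range (b + 1), (b.choose k : ℝ) * (-1) ^ k / 2 ^ (a + k + 1) /
      ((a : ℝ) + k + 1)) * L ^ (a + b + 1) =
      ∑ k ∈ range (b + 1), ((-1) ^ b * (b.choose k : ℝ) * L ^ (b - k)) *
        ((-1) ^ (a + k) * (L / 2) ^ (a + k + 1) / ((a + k : ℕ) + 1 : ℝ)) := by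
    rw [Finset.mul_sum, Finset.sum_mul]
    refine Finset.sum_congr rfl fun k hk ↦ ?_
    have hkb : k ≤ b := Nat.lt_succ_iff.1 (Finset.mem_range.1 hk)
    have hLpow : L ^ (a + b + 1) = L ^ (b - k) * L ^ (a + k + 1) := by
      rw [← pow_add]; congr 1; omega
    rw [hLpow, div_pow, pow_add (-1 : ℝ) a b, pow_add (-1 : ℝ) a k]
    push_cast
    ring
  rw [hint, hmain, ← Finset.sum_sub_distrib]
  -- termwise errors
  have hterm : ∀ k ∈ range (b + 1),
      |((-1) ^ b * (b.choose k : ℝ) * L ^ (b - k)) * (∫ u in Ioi (0 : ℝ), Real.log u ^ (a + k) * K u) -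
        ((-1) ^ b * (b.choose k : ℝ) * L ^ (b - k)) * ((-1) ^ (a + k) * (L / 2) ^ (a + k + 1) / ((a + k : ℕ) + 1 : ℝ))| ≤
      (b.choose k : ℝ) * Cf k * (1 + L) ^ (a + b) := by
    intro k hk
    have hkb : k ≤ b := Nat.lt_succ_iff.1 (Finset.mem_range.1 hk)
    rw [← mul_sub, abs_mul, abs_mul, abs_mul, abs_pow, abs_pow, abs_neg, abs_one, one_pow, one_mul,
      Nat.abs_cast, abs_of_nonneg hL0]
    have h := hCf k y hy0 hy1
    have hLk : L ^ (b - k) ≤ (1 + L) ^ (b - k) := pow_le_pow_left₀ hL0 (by linarith) _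
    calc (b.choose k : ℝ) * L ^ (b - k) * |(∫ u in Ioi (0 : ℝ), Real.log u ^ (a + k) * K u) -
          (-1) ^ (a + k) * (L / 2) ^ (a + k + 1) / ((a + k : ℕ) + 1 : ℝ)|
        ≤ (b.choose k : ℝ) * (1 + L) ^ (b - k) * (Cf k * (1 + L) ^ (a + k)) := by
          gcongr
      _ = (b.choose k : ℝ) * Cf k * ((1 + L) ^ (b - k) * (1 + L) ^ (a + k)) := by ring
      _ = (b.choose k : ℝ) * Cf k * (1 + L) ^ (a + b) := by
          rw [← pow_add]; congr 2; omega
  calc _ ≤ ∑ k ∈ range (b + 1), |((-1) ^ b * (b.choose k : ℝ) * L ^ (b - k)) *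
            (∫ u in Ioi (0 : ℝ), Real.log u ^ (a + k) * K u) -
          ((-1) ^ b * (b.choose k : ℝ) * L ^ (b - k)) *
            ((-1) ^ (a + k) * (L / 2) ^ (a + k + 1) / ((a + k : ℕ) + 1 : ℝ))| := Finset.abs_sum_le_sum_abs _ _
    _ ≤ ∑ k ∈ range (b + 1), (b.choose k : ℝ) * Cf k * (1 + L) ^ (a + b) := Finset.sum_le_sum hterm
    _ = (∑ k ∈ range (b + 1), (b.choose k : ℝ) * Cf k) * (1 + L) ^ (a + b) := by rw [Finset.sum_mul]

end Summit.Parity.GeneralizedHardyLittlewood.Theorems.MomentsBeyondDiagonal.DiagLines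

end
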